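import Summits.QuantumFields.YangMills.Theorems.SwapVirialDeficitQuantitativeLaplaceTaylorFloor
import Literature.Analysis.Calculus.LineRestrictionIteratedDeriv
import HarnessLib

/-!
# Route `SwapVirialDeficit` (YangMills): quantitative Laplace method — THE CUBIC TAYLOR DATUM from a third-derivative bound
# (the `hf`/`hρ` input of ✓`laplaceMethod_quantitative_fibred_chart_cubic`, fibrewise, with the Hessian operators chosen)

Width seat `ym-line-sfw-p2-w2` g58 (cell ym-idea-1, free hands), `--supports stmt-QuantumFields-24197`; generic glue between fcl-p3 g47's jets (W4: bounds on
`|d³∕dt³ F̂(p, t·y)|`, i.e. on `|D³g_p(z)[y,y,y]|` by ✓`iteratedDeriv_lineRestriction`) and the `1∕√b` fibred core of this seat (✓p828132).  For a fibre phase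
`g_p : V → ℝ` of class `C³` with `g_p(0) = 0`, `Dg_p(0) = 0` and `|D³g_p(z)[u,u,u]| ≤ A₃‖u‖³` on `B̄(0,R)`:

* §0 ★ `third_bound_of_lineJet`, `third_bound_directional_of_lineJet`, `iteratedFDeriv_two_eq_lineJet` — fcl-p3 g47's LINE JETS (K7b ✓`taylor_four_gnoDeficit_line`:
  `|ψ‴(s)| ≤ …` for `ψ(s) = F̂(η + sξ)`, every `η`, `ξ`) ARE the directional `D³`∕`D²` data of this seat's files (✓`iteratedDeriv_lineRestriction`).
* §1 ★★ `cubicDatum_of_third` — `|g y − ½D²g(0)[y,y]| ≤ (A₃∕6)‖y‖³` for `‖y‖ ≤ R` (✓`taylor_two_segment` at `x₀ = 0`).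
* §2 ★★★ `cubicData_of_third` — fibrewise over any index set `M`, with the symmetric HESSIAN OPERATORS `A p` of ✓`exists_hessianOperator` CHOSEN:
  `∃ A : M → V →ₗ[ℝ] V`, `A p` symmetric, `⟪A p y, y⟫ = D²g_p(0)[y,y]`, and `|g_p y − ½⟪A p y, y⟫| ≤ (A₃∕6)‖y‖³` on `‖y‖ ≤ R` — so `ρ(p,y) := g_p y − ½⟪A p y,y⟫` is the cubic
  remainder of ✓`laplaceMethod_quantitative_fibred_chart_cubic` (`hf` holds by definition, `hρ` with constant `A₃∕6`); `inner_hessianOperator_eq` rewrites `⟪A p y, y⟫` back to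
  `iteratedFDeriv` letters (for the measurability `hAm` ∕ `hρ_meas` and the coercivity `hcoer`, cf. ✓`hessianOperator_coercive`).

HONEST FRAMING: generic calculus; no model object appears; ⟨24197⟩ `SwapGluedStiffness`, ⟨24196⟩, ⟨22884⟩ stay OPEN; no stub ∕ crux ∕ rung ∕ summit is closed; the Yang–Mills
mass gap is NOT proved; no summit is proved by a line.  0 definitions, 0 `sorry`, standard axioms.  References: [cite: HasenpflugRudolfSprungk2024, §3.1 Assumption 2], [folklore].
-/

set_option linter.style.longLine false
set_option linter.style.longFile 0
set_option linter.unusedSectionVars false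

noncomputable section

open _root_.Set _root_.Metric
open scoped _root_.InnerProductSpace

namespace Summit.QuantumFields.YangMills.Theorems.QuantitativeLaplace

variable {V : Type*} [NormedAddCommGroup V] [InnerProductSpace ℝ V]

/-- ★ **LINE JETS ⟹ the directional `D³` bound**: a bound on the third derivative AT `s = 0` of every line restriction `s ↦ g(z + s·ξ)`, `z` in a set `S`,
is the bound `|D³g(z)[ξ,ξ,ξ]| ≤ A₃‖ξ‖³` on `S` (✓`iteratedDeriv_lineRestriction`) — the format of fcl-p3 g47's ✓`taylor_four_gnoDeficit_line` (K7b: every base point,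
every direction). [folklore] -/
theorem third_bound_of_lineJet {g : V → ℝ} (hg : ContDiff ℝ 3 g) {S : Set V} {A₃ : ℝ}
    (h : ∀ z ∈ S, ∀ ξ : V, |iteratedDeriv 3 (fun s : ℝ => g (z + s • ξ)) 0| ≤ A₃ * ‖ξ‖ ^ 3) :
    ∀ z ∈ S, ∀ u : V, |iteratedFDeriv ℝ 3 g z (fun _ => u)| ≤ A₃ * ‖u‖ ^ 3 := by
  intro z hz u
  have e := Literature.Analysis.Calculus.iteratedDeriv_lineRestriction (n := 3) hg z u 0
  rw [zero_smul, add_zero] at e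
  rw [← e]
  exact h z hz u

/-- ★ **LINE JETS in MIXED norms ⟹ the directional mixed-norm `D³` bound** of ✓`taylor_floor_of_third_directional` ∕ ✓`form_floor_of_third_directional`
(`|D³g(z)[u,u,u]| ≤ M·N(u)·‖u‖²`, any gauge `N`). [folklore] -/
theorem third_bound_directional_of_lineJet {g : V → ℝ} (hg : ContDiff ℝ 3 g) {S : Set V} {N : V → ℝ} {M : ℝ}
    (h : ∀ z ∈ S, ∀ ξ : V, |iteratedDeriv 3 (fun s : ℝ => g (z + s • ξ)) 0| ≤ M * N ξ * ‖ξ‖ ^ 2) :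
    ∀ z ∈ S, ∀ u : V, |iteratedFDeriv ℝ 3 g z (fun _ => u)| ≤ M * N u * ‖u‖ ^ 2 := by
  intro z hz u
  have e := Literature.Analysis.Calculus.iteratedDeriv_lineRestriction (n := 3) hg z u 0
  rw [zero_smul, add_zero] at e
  rw [← e]
  exact h z hz u

/-- ★ **LINE JETS ⟹ the Hessian form**: `D²g(z)[ξ,ξ] = (d²∕ds²) g(z + s·ξ)|_{s=0}` — so a ray∕line Hessian floor `λ‖ξ‖² ≤ ψ″(0)` is the `hlam`∕`hfloor` of
✓`form_floor_of_third_directional` ∕ ✓`fibrePackage_of_hessian_floor`. [folklore] -/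
theorem iteratedFDeriv_two_eq_lineJet {g : V → ℝ} (hg : ContDiff ℝ 2 g) (z ξ : V) :
    iteratedFDeriv ℝ 2 g z (fun _ => ξ) = iteratedDeriv 2 (fun s : ℝ => g (z + s • ξ)) 0 := by
  have e := Literature.Analysis.Calculus.iteratedDeriv_lineRestriction (n := 2) hg z ξ 0
  rw [zero_smul, add_zero] at e
  exact e.symm

/-- ★★ **The cubic Taylor datum from a `D³` bound**: `g ∈ C³`, `g 0 = 0`, `Dg(0) = 0`, `|D³g(z)[u,u,u]| ≤ A₃‖u‖³` for `z ∈ B̄(0,R)` ⟹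
`|g y − ½D²g(0)[y,y]| ≤ (A₃∕6)‖y‖³` for `‖y‖ ≤ R`. [folklore] -/
theorem cubicDatum_of_third {g : V → ℝ} (hg : ContDiff ℝ 3 g) (hg0 : g 0 = 0) (hg1 : fderiv ℝ g 0 = 0) {R A₃ : ℝ}
    (h3 : ∀ z ∈ closedBall (0 : V) R, ∀ u : V, |iteratedFDeriv ℝ 3 g z (fun _ => u)| ≤ A₃ * ‖u‖ ^ 3) :
    ∀ y : V, ‖y‖ ≤ R → |g y - (1 / 2) * iteratedFDeriv ℝ 2 g 0 (fun _ => y)| ≤ A₃ / 6 * ‖y‖ ^ 3 := by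
  intro y hy
  obtain ⟨ξ, hξ, hT⟩ := taylor_two_segment hg 0 y
  simp only [hg0, hg1, _root_.zero_apply, sub_zero, zero_add] at hT
  have hmem : (0 : V) + ξ • y ∈ closedBall (0 : V) R := by
    rw [zero_add, mem_closedBall, dist_zero_right, norm_smul, Real.norm_eq_abs, abs_of_nonneg hξ.1]
    calc ξ * ‖y‖ ≤ 1 * ‖y‖ := mul_le_mul_of_nonneg_right hξ.2 (norm_nonneg _)
      _ = ‖y‖ := one_mul _
      _ ≤ R := hy
  have hb := h3 _ hmem y
  simp only [zero_add] at hb hT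
  have e : g y - (1 / 2) * iteratedFDeriv ℝ 2 g 0 (fun _ => y) = (1 / 6) * iteratedFDeriv ℝ 3 g (ξ • y) (fun _ => y) := by
    rw [hT]; ring
  rw [e, abs_mul, abs_of_pos (by norm_num : (0 : ℝ) < 1 / 6)]
  calc 1 / 6 * |iteratedFDeriv ℝ 3 g (ξ • y) (fun _ => y)| ≤ 1 / 6 * (A₃ * ‖y‖ ^ 3) := by gcongr
    _ = A₃ / 6 * ‖y‖ ^ 3 := by ring

variable [FiniteDimensional ℝ V]

/-- ★★★ **The cubic Taylor DATA of a fibred phase, Hessian operators chosen.**  For `g : M → V → ℝ` with every fibre `C³`, `g p 0 = 0`, `D(g p)(0) = 0` and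
`|D³(g p)(z)[u,u,u]| ≤ A₃‖u‖³` on `B̄(0,R)`: there are SYMMETRIC `A p : V →ₗ[ℝ] V` with `⟪A p y, w⟫ = D(D(g p))(0)[y][w]`, `⟪A p y, y⟫ = D²(g p)(0)[y,y]` and
`|g p y − ½⟪A p y, y⟫| ≤ (A₃∕6)‖y‖³` for `‖y‖ ≤ R` — the inputs `hA`, `hf` (with `ρ(p,y) := g p y − ½⟪A p y,y⟫`, an identity) and `hρ` of
✓`laplaceMethod_quantitative_fibred_chart_cubic`. [cite: HasenpflugRudolfSprungk2024, §3.1 Assumption 2] [folklore] -/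
theorem cubicData_of_third {M : Type*} {g : M → V → ℝ} (hg : ∀ p, ContDiff ℝ 3 (g p)) (hg0 : ∀ p, g p 0 = 0) (hg1 : ∀ p, fderiv ℝ (g p) 0 = 0)
    {R A₃ : ℝ} (h3 : ∀ p, ∀ z ∈ closedBall (0 : V) R, ∀ u : V, |iteratedFDeriv ℝ 3 (g p) z (fun _ => u)| ≤ A₃ * ‖u‖ ^ 3) :
    ∃ A : M → V →ₗ[ℝ] V, (∀ p, (A p).IsSymmetric) ∧ (∀ p (y w : V), ⟪A p y, w⟫_ℝ = fderiv ℝ (fderiv ℝ (g p)) 0 y w) ∧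
      (∀ p (y : V), ⟪A p y, y⟫_ℝ = iteratedFDeriv ℝ 2 (g p) 0 (fun _ => y)) ∧
      ∀ p (y : V), ‖y‖ ≤ R → |g p y - (1 / 2) * ⟪A p y, y⟫_ℝ| ≤ A₃ / 6 * ‖y‖ ^ 3 := by
  have h2 : (2 : WithTop ℕ∞) ≤ 3 := by exact_mod_cast (show (2 : ℕ) ≤ 3 by norm_num)
  have hex := fun p => exists_hessianOperator ((hg p).contDiffAt (x := (0 : V))) h2
  choose A hAs hAyw hAyy using hex
  refine ⟨A, hAs, hAyw, hAyy, fun p y hy => ?_⟩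
  rw [hAyy]
  exact cubicDatum_of_third (hg p) (hg0 p) (hg1 p) (h3 p) y hy

omit [FiniteDimensional ℝ V] in
/-- ★ **Rewriting the operator form back to `iteratedFDeriv` letters, uncurried** — for the measurability hypotheses `hAm` ∕ `hρ_meas` of the fibred cores: with
`⟪A p y, y⟫ = D²(g p)(0)[y,y]` for all `p, y`, the map `z ↦ ⟪A z.1 z.2, z.2⟫` IS `z ↦ D²(g z.1)(0)[z.2, z.2]`. [folklore] -/
theorem inner_hessianOperator_eq {M : Type*} {g : M → V → ℝ} {A : M → V →ₗ[ℝ] V}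
    (hA : ∀ p (y : V), ⟪A p y, y⟫_ℝ = iteratedFDeriv ℝ 2 (g p) 0 (fun _ => y)) :
    (fun z : M × V => ⟪A z.1 z.2, z.2⟫_ℝ) = fun z : M × V => iteratedFDeriv ℝ 2 (g z.1) 0 (fun _ => z.2) :=
  funext fun z => hA z.1 z.2

end Summit.QuantumFields.YangMills.Theorems.QuantitativeLaplace

end
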